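import Summits.NavierStokesRegularity.NavierStokesRegularity.Theses.HodographBetchov
import Summits.NavierStokesRegularity.NavierStokesRegularity.Theorems.FastClassSqueeze.Negative.FalseWithoutLerayHopf
import Literature.Analysis.FluidPDE.VorticityCalculus
import Literature.Analysis.FluidPDE.VectorCalculusProofs
import Literature.Analysis.FluidPDE.RusinSverakCompactnessProofs

/-!
# `FastClassSqueeze` is not kinematic, part 1/2: the self-similar-rate collapsing blob

Negative-side support for the crux `FastClassSqueeze` (stmt-NavierStokesRegularity-15832, route
`HodographBetchov`, rank 3), refuter crux-disprover cycle 1 (2026-08-17); the witness for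
`FalseKinematic.lean` (part 2/2, theorem `fastClassSqueeze_false_kinematic`). Definitions and their
kinematic/energetic properties only; nothing here asserts a Theses statement.

* `biaxProfile` — `U = curl (χ A)` with `A(x) = (x₁x₂, −x₀x₂, 0)` (`quadPot`, `curl A = (x₀, x₁, −2x₂) = B x`,
  `curl_quadPot`) and `χ` a `ContDiffBump` equal to `1` on the unit ball (`cutoff`): smooth
  (`contDiff_biaxProfile`), compactly supported (`hasCompactSupport_biaxProfile`), divergence free
  (`divergence_biaxProfile`, `div curl = 0` = `divergence_curl_eq_zero_holds`), and EQUAL TO THE BIAXIAL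
  STRAIN `B = diag(1,1,−2)` ON THE UNIT BALL (`biaxProfile_of_mem_ball`), with finite `∫|U|²`, `∫|∇U|²`.
* `rate t = (1 − t)^{-1/2}` — the self-similar (Type-I) collapse rate towards `T = 1`; `blobSlice c`
  — the dilated amplified copy `x ↦ c U(c x)`; `blob t = blobSlice (rate t)` — THE WITNESS.
* kinematics/energetics of the witness on `[0,1)`: jointly smooth (`blob_isSmoothSpaceTimeOn`),
  divergence free (`blob_isDivFree`), compactly supported slices (`blob_hasCompactSupport`), energy
  `∫|u(t)|² = λ⁻¹∫|U|² = √(1−t)∫|U|²` finite and non-increasing (`lintegral_blobSlice_sq`,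
  `blob_energy_lt_top`, `blob_energy_antitone`), gradient `∇u(t) = λ²∇U(λ·)` (`fderiv_blob`) with
  finite total dissipation `∫₀¹∫|∇u|² = ∫₀¹λ · ∫|∇U|² < ∞` (`blob_dissipation_lt_top`), and the
  Type-I bound `‖u(t,x)‖ ≤ ‖U‖_∞ (1−t)^{-1/2}` (`blob_typeI`).
[cite: MajdaBertozzi2002, §1.4 (exact solutions with linear velocity field)]
-/


noncomputable section

-- the summit and its single problem share the name `NavierStokesRegularity` (D-0017 nested layout)
set_option linter.dupNamespace false

namespace Summit.NavierStokesRegularity.NavierStokesRegularity.Theorems.FastClassSqueeze.Negative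

open MeasureTheory Set Filter Metric Topology Function InnerProductSpace
open scoped ENNReal NNReal RealInnerProductSpace ContDiff
open Literature.Analysis.FluidPDE

/-! ## The biaxProfile `U = curl (χ A)`: smooth, compactly supported, divergence free, `= B` on the unit ball -/

/-- The quadratic vector potential `A(x) = (x₁x₂, −x₀x₂, 0)`, with `curl A = (x₀, x₁, −2x₂) = B x`. -/
def quadPot : EuclideanSpace ℝ (Fin 3) → EuclideanSpace ℝ (Fin 3) :=
  fun x => (x 1 * x 2) • ex + (-(x 0 * x 2)) • ey

/-- A smooth cut-off: `1` on the closed unit ball, supported in the ball of radius `2`. -/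
def cutoff : ContDiffBump (0 : EuclideanSpace ℝ (Fin 3)) := ⟨1, 2, one_pos, one_lt_two⟩

/-- The cut-off potential `χ A`. -/
def cutPot : EuclideanSpace ℝ (Fin 3) → EuclideanSpace ℝ (Fin 3) := fun x => cutoff x • quadPot x

/-- **The biaxProfile** `U = curl (χ A)`. -/
def biaxProfile : EuclideanSpace ℝ (Fin 3) → EuclideanSpace ℝ (Fin 3) := curl cutPot

/-- The derivative of the quadratic potential. [folklore] -/
theorem hasFDerivAt_quadPot (x : EuclideanSpace ℝ (Fin 3)) :
    HasFDerivAt quadPot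
      ((x 1 • (EuclideanSpace.proj 2 : EuclideanSpace ℝ (Fin 3) →L[ℝ] ℝ) +
          x 2 • (EuclideanSpace.proj 1 : EuclideanSpace ℝ (Fin 3) →L[ℝ] ℝ)).smulRight ex +
        (-(x 0 • (EuclideanSpace.proj 2 : EuclideanSpace ℝ (Fin 3) →L[ℝ] ℝ) +
          x 2 • (EuclideanSpace.proj 0 : EuclideanSpace ℝ (Fin 3) →L[ℝ] ℝ))).smulRight ey) x := by
  have h0 : HasFDerivAt (fun y : EuclideanSpace ℝ (Fin 3) => y 0)
      (EuclideanSpace.proj 0 : EuclideanSpace ℝ (Fin 3) →L[ℝ] ℝ) x := PiLp.hasFDerivAt_apply 2 x 0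
  have h1 : HasFDerivAt (fun y : EuclideanSpace ℝ (Fin 3) => y 1)
      (EuclideanSpace.proj 1 : EuclideanSpace ℝ (Fin 3) →L[ℝ] ℝ) x := PiLp.hasFDerivAt_apply 2 x 1
  have h2 : HasFDerivAt (fun y : EuclideanSpace ℝ (Fin 3) => y 2)
      (EuclideanSpace.proj 2 : EuclideanSpace ℝ (Fin 3) →L[ℝ] ℝ) x := PiLp.hasFDerivAt_apply 2 x 2
  exact ((h1.mul h2).smul_const ex).add (((h0.mul h2).neg).smul_const ey)

/-- The quadratic potential is smooth. [folklore] -/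
theorem contDiff_quadPot {n : WithTop ℕ∞} : ContDiff ℝ n quadPot := by
  have h0 : ContDiff ℝ n (fun y : EuclideanSpace ℝ (Fin 3) => y 0) :=
    contDiff_piLp_apply (p := 2) (i := (0 : Fin 3))
  have h1 : ContDiff ℝ n (fun y : EuclideanSpace ℝ (Fin 3) => y 1) :=
    contDiff_piLp_apply (p := 2) (i := (1 : Fin 3))
  have h2 : ContDiff ℝ n (fun y : EuclideanSpace ℝ (Fin 3) => y 2) :=
    contDiff_piLp_apply (p := 2) (i := (2 : Fin 3))
  exact ((h1.mul h2).smul contDiff_const).add ((h0.mul h2).neg.smul contDiff_const)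

/-- The cut-off potential is smooth. [folklore] -/
theorem contDiff_cutPot {n : ℕ∞} : ContDiff ℝ n cutPot := by
  show ContDiff ℝ n fun x => cutoff x • quadPot x
  exact cutoff.contDiff.smul contDiff_quadPot

/-- The cut-off potential has compact support. [folklore] -/
theorem hasCompactSupport_cutPot : HasCompactSupport cutPot :=
  cutoff.hasCompactSupport.smul_right

/-- The biaxProfile is smooth. [folklore] -/
theorem contDiff_biaxProfile {n : ℕ∞} : ContDiff ℝ n biaxProfile :=
  contDiff_curl (by exact_mod_cast contDiff_cutPot (n := n + 1))

/-- The biaxProfile has compact support. [folklore] -/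
theorem hasCompactSupport_biaxProfile : HasCompactSupport biaxProfile :=
  hasCompactSupport_curl hasCompactSupport_cutPot

/-- The biaxProfile is divergence free (`div curl = 0`). [folklore] -/
theorem divergence_biaxProfile (x : EuclideanSpace ℝ (Fin 3)) : VectorCalculus.divergence biaxProfile x = 0 :=
  divergence_curl_eq_zero_holds cutPot (by exact_mod_cast contDiff_cutPot (n := 2)) x

/-- `curl A = B` pointwise. [folklore] -/
theorem curl_quadPot (x : EuclideanSpace ℝ (Fin 3)) : curl quadPot x = strainB x := by
  have hfd := (hasFDerivAt_quadPot x).fderiv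
  ext i
  fin_cases i
  · simp [curl, hfd, ex, ey, ez, strainB_apply, Fin.ext_iff]
  · simp [curl, hfd, ex, ey, ez, strainB_apply, Fin.ext_iff]
  · simp [curl, hfd, ex, ey, ez, strainB_apply, Fin.ext_iff]
    ring

/-- On the open unit ball the cut-off potential IS the quadratic potential, so their Jacobians agree
there. [folklore] -/
theorem fderiv_cutPot_of_mem_ball {x : EuclideanSpace ℝ (Fin 3)} (hx : x ∈ ball (0 : EuclideanSpace ℝ (Fin 3)) 1) :
    fderiv ℝ cutPot x = fderiv ℝ quadPot x := by
  refine Filter.EventuallyEq.fderiv_eq ?_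
  filter_upwards [isOpen_ball.mem_nhds hx] with y hy
  show cutoff y • quadPot y = quadPot y
  rw [cutoff.one_of_mem_closedBall (ball_subset_closedBall hy), one_smul]

/-- **The biaxProfile is the biaxial strain on the unit ball**: `U = B` on `ball 0 1`. [folklore] -/
theorem biaxProfile_of_mem_ball {x : EuclideanSpace ℝ (Fin 3)} (hx : x ∈ ball (0 : EuclideanSpace ℝ (Fin 3)) 1) :
    biaxProfile x = strainB x := by
  rw [← curl_quadPot x]
  show curlCLM (fderiv ℝ cutPot x) = curlCLM (fderiv ℝ quadPot x)
  rw [fderiv_cutPot_of_mem_ball hx]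

/-- The biaxProfile is `C¹`-differentiable everywhere. [folklore] -/
theorem differentiable_biaxProfile : Differentiable ℝ biaxProfile :=
  (contDiff_biaxProfile (n := 1)).differentiable (by simp)

/-- The biaxProfile is bounded (continuous with compact support). [folklore] -/
theorem exists_bound_biaxProfile : ∃ C : ℝ, ∀ x, ‖biaxProfile x‖ ≤ C :=
  hasCompactSupport_biaxProfile.exists_bound_of_continuous (contDiff_biaxProfile (n := 0)).continuous

/-- The biaxProfile has finite energy `∫ ‖U‖² < ∞`. [folklore] -/
theorem lintegral_biaxProfile_sq_lt_top :
    ∫⁻ x, ‖biaxProfile x‖ₑ ^ 2 < ⊤ := by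
  have h : MemLp biaxProfile 2 (volume : Measure (EuclideanSpace ℝ (Fin 3))) :=
    (contDiff_biaxProfile (n := 0)).continuous.memLp_of_hasCompactSupport hasCompactSupport_biaxProfile
  have := lintegral_rpow_enorm_lt_top_of_eLpNorm_lt_top two_ne_zero ENNReal.ofNat_ne_top h.eLpNorm_lt_top
  simpa [ENNReal.toReal_ofNat] using this

/-- The biaxProfile has finite enstrophy-type integral `∫ ‖∇U‖² < ∞`. [folklore] -/
theorem lintegral_fderiv_biaxProfile_sq_lt_top :
    ∫⁻ x, ‖fderiv ℝ biaxProfile x‖ₑ ^ 2 < ⊤ := by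
  have hc : Continuous (fderiv ℝ biaxProfile) := (contDiff_biaxProfile (n := 1)).continuous_fderiv (by simp)
  have h : MemLp (fderiv ℝ biaxProfile) 2 (volume : Measure (EuclideanSpace ℝ (Fin 3))) :=
    hc.memLp_of_hasCompactSupport (hasCompactSupport_biaxProfile.fderiv (𝕜 := ℝ))
  have := lintegral_rpow_enorm_lt_top_of_eLpNorm_lt_top two_ne_zero ENNReal.ofNat_ne_top h.eLpNorm_lt_top
  simpa [ENNReal.toReal_ofNat] using this

/-! ## The self-similar-rate collapse `u(t, x) = λ U(λ x)`, `λ = (1 − t)^{-1/2}` -/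

/-- The collapse rate `λ(t) = 1/√(1 − t)` (the self-similar, Type-I rate towards `T = 1`). -/
def rate (t : ℝ) : ℝ := (Real.sqrt (1 - t))⁻¹

/-- `λ(t) > 0` for `t < 1`. [folklore] -/
theorem rate_pos {t : ℝ} (ht : t < 1) : 0 < rate t :=
  inv_pos.2 (Real.sqrt_pos.2 (by linarith))

/-- `λ(t)⁻¹ = √(1 − t)`. [folklore] -/
theorem rate_inv (t : ℝ) : (rate t)⁻¹ = Real.sqrt (1 - t) := inv_inv _

/-- `λ(t)² = (1 − t)⁻¹` for `t < 1`. [folklore] -/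
theorem rate_sq {t : ℝ} (ht : t < 1) : rate t ^ 2 = (1 - t)⁻¹ := by
  rw [rate, inv_pow, Real.sq_sqrt (by linarith)]

/-- `λ` is smooth on `t < 1`. [folklore] -/
theorem contDiffAt_rate {t : ℝ} (ht : t < 1) {n : WithTop ℕ∞} : ContDiffAt ℝ n rate t := by
  have h1 : ContDiffAt ℝ n (fun s : ℝ => 1 - s) t := contDiffAt_const.sub contDiffAt_id
  have h2 : ContDiffAt ℝ n (fun s : ℝ => Real.sqrt (1 - s)) t := h1.sqrt (by linarith)
  exact h2.inv (Real.sqrt_ne_zero'.2 (by linarith))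

/-- A dilated, amplified copy of the biaxProfile: `x ↦ c U(c x)`. -/
def blobSlice (c : ℝ) : EuclideanSpace ℝ (Fin 3) → EuclideanSpace ℝ (Fin 3) :=
  fun x => c • biaxProfile (c • x)

/-- **The witness**: the self-similar-rate collapsing blob `u(t, x) = λ(t) U(λ(t) x)`. -/
def blob : ℝ → EuclideanSpace ℝ (Fin 3) → EuclideanSpace ℝ (Fin 3) := fun t => blobSlice (rate t)

/-- `∇(c U(c ·))(x) = c² ∇U(c x)`. [folklore] -/
theorem fderiv_blobSlice (c : ℝ) (x : EuclideanSpace ℝ (Fin 3)) :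
    fderiv ℝ (blobSlice c) x = (c * c) • fderiv ℝ biaxProfile (c • x) := by
  have h1 : HasFDerivAt (fun y : EuclideanSpace ℝ (Fin 3) => c • y)
      (c • ContinuousLinearMap.id ℝ (EuclideanSpace ℝ (Fin 3))) x := (hasFDerivAt_id x).const_smul c
  have h2 : HasFDerivAt biaxProfile (fderiv ℝ biaxProfile (c • x)) (c • x) :=
    (differentiable_biaxProfile _).hasFDerivAt
  have h3 := (h2.comp x h1).const_smul c
  rw [show blobSlice c = c • (biaxProfile ∘ fun y : EuclideanSpace ℝ (Fin 3) => c • y) from rfl, h3.fderiv]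
  ext y i
  simp [mul_smul]

/-- `∇u(t) = λ² ∇U(λ ·)`. [folklore] -/
theorem fderiv_blob (t : ℝ) (x : EuclideanSpace ℝ (Fin 3)) :
    fderiv ℝ (blob t) x = (rate t * rate t) • fderiv ℝ biaxProfile (rate t • x) :=
  fderiv_blobSlice (rate t) x

/-- The witness is jointly smooth on `[0,1) × ℝ³`. [folklore] -/
theorem blob_isSmoothSpaceTimeOn : IsSmoothSpaceTimeOn (Ico 0 1) blob := by
  intro z hz
  have hz1 : z.1 < 1 := (mem_prod.1 hz).1.2
  have hr : ContDiffAt ℝ ∞ (fun w : ℝ × EuclideanSpace ℝ (Fin 3) => rate w.1) z :=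
    (contDiffAt_rate hz1).comp z contDiffAt_fst
  have hin : ContDiffAt ℝ ∞ (fun w : ℝ × EuclideanSpace ℝ (Fin 3) => rate w.1 • w.2) z :=
    hr.smul contDiffAt_snd
  have hU : ContDiffAt ℝ ∞ (fun w : ℝ × EuclideanSpace ℝ (Fin 3) => biaxProfile (rate w.1 • w.2)) z :=
    (contDiff_biaxProfile (n := ⊤)).contDiffAt.comp z hin
  exact (hr.smul hU).contDiffWithinAt

/-- The witness is divergence free at every time. [folklore] -/
theorem blob_isDivFree (t : ℝ) : VectorCalculus.IsDivFree (blob t) := by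
  intro x
  have h := divergence_biaxProfile (rate t • x)
  unfold VectorCalculus.divergence at h ⊢
  rw [fderiv_blob, ContinuousLinearMap.toLinearMap_smul, map_smul, h, smul_zero]

/-- Every slice of the witness before the collapse time has compact support. [folklore] -/
theorem blob_hasCompactSupport {t : ℝ} (ht : t < 1) : HasCompactSupport (blob t) := by
  have h1 : HasCompactSupport (fun y : EuclideanSpace ℝ (Fin 3) => biaxProfile (rate t • y)) :=
    hasCompactSupport_biaxProfile.comp_homeomorph (Homeomorph.smulOfNeZero (rate t) (rate_pos ht).ne')
  exact h1.smul_left (f := fun _ => rate t)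

/-- **Energy of the slices**: `∫ |c U(c x)|² dx = c⁻¹ ∫ |U|²` (`c > 0`). [folklore] -/
theorem lintegral_blobSlice_sq {c : ℝ} (hc : 0 < c) :
    ∫⁻ x, ‖blobSlice c x‖ₑ ^ 2 = ENNReal.ofReal c⁻¹ * ∫⁻ x, ‖biaxProfile x‖ₑ ^ 2 := by
  have h1 : ∀ x, ‖blobSlice c x‖ₑ ^ 2 = ENNReal.ofReal (c ^ 2) * ‖biaxProfile (c • x)‖ₑ ^ 2 := by
    intro x
    rw [blobSlice, enorm_smul, mul_pow, Real.enorm_eq_ofReal hc.le, ENNReal.ofReal_pow hc.le]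
  simp_rw [h1]
  rw [lintegral_const_mul' _ _ ENNReal.ofReal_ne_top,
    HomSobolevSymmetry.lintegral_comp_smul (fun x => ‖biaxProfile x‖ₑ ^ 2) hc, ← mul_assoc, ← ENNReal.ofReal_mul (by positivity)]
  congr 2
  field_simp

/-- **Dissipation of the slices**: `∫ |∇(c U(c ·))|² = c ∫ |∇U|²` (`c > 0`). [folklore] -/
theorem lintegral_fderiv_blobSlice_sq {c : ℝ} (hc : 0 < c) :
    ∫⁻ x, ‖fderiv ℝ (blobSlice c) x‖ₑ ^ 2 = ENNReal.ofReal c * ∫⁻ x, ‖fderiv ℝ biaxProfile x‖ₑ ^ 2 := by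
  have h1 : ∀ x, ‖fderiv ℝ (blobSlice c) x‖ₑ ^ 2 =
      ENNReal.ofReal ((c * c) ^ 2) * ‖fderiv ℝ biaxProfile (c • x)‖ₑ ^ 2 := by
    intro x
    rw [fderiv_blobSlice, enorm_smul, mul_pow, Real.enorm_eq_ofReal (mul_self_nonneg c),
      ENNReal.ofReal_pow (mul_self_nonneg c)]
  simp_rw [h1]
  rw [lintegral_const_mul' _ _ ENNReal.ofReal_ne_top,
    HomSobolevSymmetry.lintegral_comp_smul (fun x => ‖fderiv ℝ biaxProfile x‖ₑ ^ 2) hc, ← mul_assoc,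
    ← ENNReal.ofReal_mul (by positivity)]
  congr 2
  field_simp

/-- The energy of the witness is finite at every time before the collapse. [folklore] -/
theorem blob_energy_lt_top {t : ℝ} (ht : t < 1) : ∫⁻ x, ‖blob t x‖ₑ ^ 2 < ⊤ := by
  rw [blob, lintegral_blobSlice_sq (rate_pos ht)]
  exact ENNReal.mul_lt_top ENNReal.ofReal_lt_top lintegral_biaxProfile_sq_lt_top

/-- **The energy of the witness is non-increasing** (`= √(1−t) ∫|U|²`). [folklore] -/
theorem blob_energy_antitone {s t : ℝ} (ht : t < 1) (hst : s ≤ t) :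
    ∫⁻ x, ‖blob t x‖ₑ ^ 2 ≤ ∫⁻ x, ‖blob s x‖ₑ ^ 2 := by
  rw [blob, blob, lintegral_blobSlice_sq (rate_pos ht), lintegral_blobSlice_sq (rate_pos (hst.trans_lt ht)),
    rate_inv, rate_inv]
  gcongr

/-- `∫₀¹ λ(t) dt < ∞` (`λ = (1 − t)^{-1/2}` is integrable at `1⁻`). [folklore] -/
theorem lintegral_rate_lt_top : ∫⁻ t in Ioo (0 : ℝ) 1, ENNReal.ofReal (rate t) < ⊤ := by
  have h1 : IntervalIntegrable (fun x : ℝ => x ^ (-(2⁻¹ : ℝ))) volume 1 0 :=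
    intervalIntegral.intervalIntegrable_rpow' (by norm_num)
  have h2 := h1.comp_sub_left 1
  rw [sub_self, sub_zero] at h2
  have h3 : IntegrableOn (fun x : ℝ => (1 - x) ^ (-(2⁻¹ : ℝ))) (Ioo 0 1) :=
    (intervalIntegrable_iff_integrableOn_Ioo_of_le zero_le_one).1 h2
  have h4 := h3.lintegral_lt_top
  refine lt_of_le_of_lt (le_of_eq (setLIntegral_congr_fun measurableSet_Ioo fun t ht => ?_)) h4
  rw [rate, Real.sqrt_eq_rpow, one_div, Real.rpow_neg (by linarith [ht.2])]

/-- **The total dissipation of the witness is finite** (`= ∫₀¹ λ · ∫|∇U|² = 2∫|∇U|²`). [folklore] -/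
theorem blob_dissipation_lt_top :
    ∫⁻ t in Ioo (0 : ℝ) 1, ∫⁻ x, ‖fderiv ℝ (blob t) x‖ₑ ^ 2 < ⊤ := by
  have h1 : ∀ t ∈ Ioo (0 : ℝ) 1, ∫⁻ x, ‖fderiv ℝ (blob t) x‖ₑ ^ 2 =
      ENNReal.ofReal (rate t) * ∫⁻ x, ‖fderiv ℝ biaxProfile x‖ₑ ^ 2 :=
    fun t ht => lintegral_fderiv_blobSlice_sq (rate_pos ht.2)
  rw [setLIntegral_congr_fun measurableSet_Ioo h1, lintegral_mul_const' _ _ lintegral_fderiv_biaxProfile_sq_lt_top.ne]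
  exact ENNReal.mul_lt_top lintegral_rate_lt_top lintegral_fderiv_biaxProfile_sq_lt_top

/-- **The witness blows up at the Type-I (self-similar) rate**: `‖u(t,x)‖ ≤ ‖U‖_∞ / √(1 − t)`. [folklore] -/
theorem blob_typeI : ∃ M : ℝ, ∀ t ∈ Ico (0 : ℝ) 1, ∀ x, ‖blob t x‖ ≤ M / Real.sqrt (1 - t) := by
  obtain ⟨C, hC⟩ := exists_bound_biaxProfile
  refine ⟨C, fun t ht x => ?_⟩
  show ‖rate t • biaxProfile (rate t • x)‖ ≤ C / Real.sqrt (1 - t)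
  rw [norm_smul, Real.norm_eq_abs, abs_of_pos (rate_pos ht.2), rate, div_eq_mul_inv, mul_comm]
  exact mul_le_mul_of_nonneg_right (hC _) (inv_nonneg.2 (Real.sqrt_nonneg _))

end Summit.NavierStokesRegularity.NavierStokesRegularity.Theorems.FastClassSqueeze.Negative

end
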